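import Mathlib
import HarnessLib

/-!
# `NoHeavyLowerTail` (stmt-CriticalPhenomena-4575), line fat-minority-linear — the THRESHOLD BOOKKEEPING (T5) behind
# the Case-I step (route task `nh-dp-fatminority`, gen 9; PROOF-INDUCTION-modulo-C2.md, tool T5)

Pure real arithmetic, recorded so that the hypothesis `ht₀` of `upsetStar_caseI_step`
(`…FatMinorityCaseIStep.lean`) is traced back to the slack edge lemma.  Dictionary (star of `o`, port `z`, `e = s(o,z)` of
weight `p`, laws `μ`, `μ₀ = μ_{w[e↦0]}`, `μ₁ = μ_{w[e↦1]}`): `R t = μ(t↔b) = (1−p)·R₀ t + p·R₁ t` (one-bond decomposition),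
`piv t = R₁ t − R₀ t` (pivotality of `e` for `t ↔ b`), `v₀` the least reliable port (`R v₀ ≤ R v`), `σ_z = R z − R v₀`,
`E = σ_z + (1−p)(piv z − piv c)`, and the SLACK EDGE LEMMA at `z` for the port `v`: `(1−p)(piv v − piv z) ≤ σ_z`.
Conclusion (`threshold_bookkeeping`): `(1−p)(R₀ c − R₀ v) ≤ (1−p)(R c − R v₀) + p·E`, i.e. the QUT4-threshold of the deleted
graph exceeds the original one by at most `(p/(1−p))·E`; `threshold_bookkeeping_posPart` is the form with positive parts used as
`ht₀ : (1 − p)·t₀ ≤ (1 − p)·t + p·E` (`t₀ = (R₀ c − R₀ v)⁺`, `t = (R c − R v₀)⁺`).  No definitions.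
-/

namespace Summit.CriticalPhenomena.PercolationContinuityZ3.Theorems

/-- **Threshold bookkeeping (T5).**  With `R t = (1−p) R₀ t + p R₁ t` for `t ∈ {c, v}` (`R z`, `R₀ z`, `R₁ z` enter only through the edge lemma), `R v₀ ≤ R v`, `0 ≤ p ≤ 1` and the slack
edge lemma `(1−p)((R₁ v − R₀ v) − (R₁ z − R₀ z)) ≤ R z − R v₀`:
`(1−p)(R₀ c − R₀ v) ≤ (1−p)(R c − R v₀) + p·[(R z − R v₀) + (1−p)((R₁ z − R₀ z) − (R₁ c − R₀ c))]`.
[cite: KozmaNitzan2024, Lemma 4 p. 9 (pivotality comparison, qualitative); this bookkeeping: route notes gen 8 (B2) / gen 9 (T5)] -/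
theorem threshold_bookkeeping {p Rc Rv Rz Rv₀ R₀c R₀v R₀z R₁c R₁v R₁z : ℝ}
    (hp0 : 0 ≤ p) (hp1 : p ≤ 1)
    (hc : Rc = (1 - p) * R₀c + p * R₁c) (hv : Rv = (1 - p) * R₀v + p * R₁v)
    (hmin : Rv₀ ≤ Rv)
    (hedge : (1 - p) * ((R₁v - R₀v) - (R₁z - R₀z)) ≤ Rz - Rv₀) :
    (1 - p) * (R₀c - R₀v) ≤
      (1 - p) * (Rc - Rv₀) + p * ((Rz - Rv₀) + (1 - p) * ((R₁z - R₀z) - (R₁c - R₀c))) := by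
  have h1p : 0 ≤ 1 - p := by linarith
  -- (1−p)(R₀c − R₀v) = (1−p)(Rc − Rv) + (1−p)·p·((R₁v − R₀v) − (R₁c − R₀c))
  have key : (1 - p) * (R₀c - R₀v) =
      (1 - p) * (Rc - Rv) + (1 - p) * p * ((R₁v - R₀v) - (R₁c - R₀c)) := by
    rw [hc, hv]; ring
  rw [key]
  -- the slack edge lemma times p ≥ 0, and Rv ≥ Rv₀ times (1 − p) ≥ 0
  have h2 : p * ((1 - p) * ((R₁v - R₀v) - (R₁z - R₀z))) ≤ p * (Rz - Rv₀) := mul_le_mul_of_nonneg_left hedge hp0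
  have h3 : (1 - p) * (Rc - Rv) ≤ (1 - p) * (Rc - Rv₀) := mul_le_mul_of_nonneg_left (by linarith) h1p
  nlinarith [h2, h3]

/-- Positive-part form of the threshold bookkeeping: with `t₀ = (R₀ c − R₀ v)⁺`, `t = (R c − R v₀)⁺` and
`E = (R z − R v₀) + (1−p)((R₁ z − R₀ z) − (R₁ c − R₀ c)) ≥ 0`:  `(1 − p)·t₀ ≤ (1 − p)·t + p·E`
(the hypothesis `ht₀` of `upsetStar_caseI_step`, one port `v` at a time). [cite: KozmaNitzan2024, Lemma 4 p. 9; route notes gen 9 (T5)] -/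
theorem threshold_bookkeeping_posPart {p Rc Rv Rz Rv₀ R₀c R₀v R₀z R₁c R₁v R₁z : ℝ}
    (hp0 : 0 ≤ p) (hp1 : p ≤ 1)
    (hc : Rc = (1 - p) * R₀c + p * R₁c) (hv : Rv = (1 - p) * R₀v + p * R₁v)
    (hmin : Rv₀ ≤ Rv)
    (hedge : (1 - p) * ((R₁v - R₀v) - (R₁z - R₀z)) ≤ Rz - Rv₀)
    (hE : 0 ≤ (Rz - Rv₀) + (1 - p) * ((R₁z - R₀z) - (R₁c - R₀c))) :
    (1 - p) * max 0 (R₀c - R₀v) ≤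
      (1 - p) * max 0 (Rc - Rv₀) + p * ((Rz - Rv₀) + (1 - p) * ((R₁z - R₀z) - (R₁c - R₀c))) := by
  have h := threshold_bookkeeping hp0 hp1 hc hv hmin hedge
  have h1p : 0 ≤ 1 - p := by linarith
  rcases le_or_gt (R₀c - R₀v) 0 with hneg | hpos
  · rw [max_eq_left hneg, mul_zero]
    exact add_nonneg (mul_nonneg h1p (le_max_left _ _)) (mul_nonneg hp0 hE)
  · rw [max_eq_right hpos.le]
    have h2 : (1 - p) * (Rc - Rv₀) ≤ (1 - p) * max 0 (Rc - Rv₀) := mul_le_mul_of_nonneg_left (le_max_right _ _) h1p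
    linarith

end Summit.CriticalPhenomena.PercolationContinuityZ3.Theorems
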